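import Mathlib.MeasureTheory.Integral.Layercake
import Mathlib.Probability.Moments.Covariance
import HarnessLib

/-!
# `StressStrongMixing` · line `birth`, stub F3static `stub_staticClustering`, part 1a:
# from pinning of superlevel sets along a disintegration to a covariance bound (abstract `φ`-mixing lemma)

Support file for the crux item stmt-AtomisticToContinuum-9584 (`StressStrongMixing`, route `MourreKoopmanCharges` of
`AtomisticToContinuum/HydrodynamicLimit`), line `birth`, registered stub `stub_staticClustering` (F3static).

Setting: a probability space `(Ω, μ)` disintegrated along a family of measures `γ_Y`, `∫ F dμ = ∫ (∫ F dγ_Y) dμ(Y)` for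
measurable `F ≥ 0` (for the hard-sphere gas: the DLR equations for functions along the specification of a ball).

* layer cake: if two measures give to all superlevel sets `{t < f}` of a bounded measurable `f` (`|f| ≤ C`) masses
  differing by `≤ e`, their integrals of `f + C` differ by `≤ 2 C e`
  (`lintegral_ofReal_le_add_of_meas_lt_le`, `lintegral_shift_le_add_of_pinning`);
* if this pinning holds for all pairs `Y, Y'` in a set `S` of full `μ`-measure, then `|γ_Y(f + C) - μ(f + C)| ≤ 2 C e`
  for every `Y ∈ S` (`lintegral_shift_le_lintegral_add_of_pinning`, `lintegral_le_lintegral_shift_add_of_pinning`);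
* if moreover `g` is "measurable outside", i.e. `∫ F · φ(g) dγ_Y = φ(g(Y)) ∫ F dγ_Y`, then
  `|E_μ[f g] - E_μ[f] E_μ[g]| ≤ 2 C e E_μ|g|` (`abs_integral_mul_sub_le_of_pinning`), i.e.
  `|Cov_μ(f, g)| ≤ 2 C e ‖g‖₁` (`abs_cov_le_of_pinning`) — the classical `φ`-mixing covariance inequality
  (Ibragimov 1962; Doukhan, *Mixing* (1994), §1.2.2 Thm 3), here derived from a specification.

References: P. Doukhan, *Mixing: Properties and Examples*, LNS 85 (1994), §1.2.2; H.-O. Georgii, *Gibbs Measures and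
Phase Transitions* (2011), Def. 1.23, §8.3.
-/

noncomputable section

open MeasureTheory ProbabilityTheory Filter Topology
open scoped ENNReal

namespace Summit.AtomisticToContinuum.HydrodynamicLimit.Theorems.MourreKoopmanChargesStressStrongMixing

/-! ### Abstract part: from pinning of superlevel sets to a covariance bound -/

section Abstract

variable {Ω : Type*} [MeasurableSpace Ω]

/-- **Layer cake comparison**: if `0 ≤ f ≤ C` is measurable and `P {t < f} ≤ Q {t < f} + e` for `0 < t < C`, then
`∫ f dP ≤ ∫ f dQ + e C` (as lower integrals). [folklore] -/
theorem lintegral_ofReal_le_add_of_meas_lt_le (P Q : Measure Ω) {f : Ω → ℝ} (hf : Measurable f) {C : ℝ}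
    (hf0 : ∀ ω, 0 ≤ f ω) (hfC : ∀ ω, f ω ≤ C) {e : ℝ≥0∞}
    (h : ∀ t : ℝ, 0 < t → t < C → P {ω | t < f ω} ≤ Q {ω | t < f ω} + e) :
    ∫⁻ ω, ENNReal.ofReal (f ω) ∂P ≤ ∫⁻ ω, ENNReal.ofReal (f ω) ∂Q + e * ENNReal.ofReal C := by
  rw [lintegral_eq_lintegral_meas_lt P (ae_of_all _ hf0) hf.aemeasurable,
    lintegral_eq_lintegral_meas_lt Q (ae_of_all _ hf0) hf.aemeasurable]
  have hind : Measurable fun t : ℝ => e * (Set.Iio C).indicator (1 : ℝ → ℝ≥0∞) t :=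
    measurable_const.mul (measurable_one.indicator measurableSet_Iio)
  have hpt : ∀ t ∈ Set.Ioi (0 : ℝ),
      P {ω | t < f ω} ≤ Q {ω | t < f ω} + e * (Set.Iio C).indicator (1 : ℝ → ℝ≥0∞) t := by
    intro t ht
    by_cases htC : t < C
    · rw [Set.indicator_of_mem (Set.mem_Iio.2 htC), Pi.one_apply, mul_one]
      exact h t ht htC
    · have hempty : {ω | t < f ω} = ∅ :=
        Set.eq_empty_of_forall_notMem fun ω hω => htC (lt_of_lt_of_le hω (hfC ω))
      rw [hempty, measure_empty]
      exact bot_le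
  have hC : ∫⁻ t in Set.Ioi (0 : ℝ), e * (Set.Iio C).indicator (1 : ℝ → ℝ≥0∞) t ≤ e * ENNReal.ofReal C := by
    rw [lintegral_const_mul _ (measurable_one.indicator measurableSet_Iio), lintegral_indicator_one measurableSet_Iio,
      Measure.restrict_apply measurableSet_Iio, Set.Iio_inter_Ioi, Real.volume_Ioo, sub_zero]
  calc ∫⁻ t in Set.Ioi 0, P {ω | t < f ω}
      ≤ ∫⁻ t in Set.Ioi 0, (Q {ω | t < f ω} + e * (Set.Iio C).indicator (1 : ℝ → ℝ≥0∞) t) :=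
        setLIntegral_mono' measurableSet_Ioi hpt
    _ = (∫⁻ t in Set.Ioi 0, Q {ω | t < f ω}) +
          ∫⁻ t in Set.Ioi (0 : ℝ), e * (Set.Iio C).indicator (1 : ℝ → ℝ≥0∞) t :=
        lintegral_add_right' _ hind.aemeasurable
    _ ≤ (∫⁻ t in Set.Ioi 0, Q {ω | t < f ω}) + e * ENNReal.ofReal C := add_le_add le_rfl hC

variable (γ : Ω → Measure Ω)

/-- **Pinning of superlevel sets pins bounded functions**: if `|f| ≤ C` and `γ_Y {t < f} ≤ γ_{Y'} {t < f} + e` for all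
`t`, then `∫ (f + C) dγ_Y ≤ ∫ (f + C) dγ_{Y'} + e · 2C`. [folklore] -/
theorem lintegral_shift_le_add_of_pinning {f : Ω → ℝ} (hf : Measurable f) {C : ℝ} (hfC : ∀ ω, |f ω| ≤ C)
    {e : ℝ≥0∞} {Y Y' : Ω} (h : ∀ t : ℝ, γ Y {ω | t < f ω} ≤ γ Y' {ω | t < f ω} + e) :
    ∫⁻ ω, ENNReal.ofReal (f ω + C) ∂(γ Y) ≤ ∫⁻ ω, ENNReal.ofReal (f ω + C) ∂(γ Y') + e * ENNReal.ofReal (2 * C) := by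
  refine lintegral_ofReal_le_add_of_meas_lt_le (γ Y) (γ Y') (hf.add_const C) (fun ω => ?_) (fun ω => ?_)
    fun t _ _ => ?_
  · linarith [(abs_le.1 (hfC ω)).1]
  · linarith [(abs_le.1 (hfC ω)).2]
  · have hset : {ω | t < f ω + C} = {ω | t - C < f ω} := by
      ext ω
      simp only [Set.mem_setOf_eq]
      exact ⟨fun h' => by linarith, fun h' => by linarith⟩
    rw [hset]
    exact h (t - C)

variable {μ : Measure Ω} [IsProbabilityMeasure μ]

/-- **DLR transport of the pinning, upper bound**: if the pinning of the superlevel sets of `f` (`|f| ≤ C`) holds for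
all pairs of boundary conditions in a set `S` of full measure and `μ = ∫ γ_Y dμ(Y)` on functions, then
`∫ (f + C) dγ_Y ≤ ∫ (f + C) dμ + 2 C e` for every `Y ∈ S`. [folklore] -/
theorem lintegral_shift_le_lintegral_add_of_pinning
    (hDLR : ∀ F : Ω → ℝ≥0∞, Measurable F → ∫⁻ X, F X ∂μ = ∫⁻ Y, ∫⁻ X, F X ∂(γ Y) ∂μ)
    {S : Set Ω} (hS : ∀ᵐ Y ∂μ, Y ∈ S) {f : Ω → ℝ} (hf : Measurable f) {C : ℝ} (hfC : ∀ ω, |f ω| ≤ C) {e : ℝ≥0∞}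
    (hpin : ∀ Y ∈ S, ∀ Y' ∈ S, ∀ t : ℝ, γ Y {ω | t < f ω} ≤ γ Y' {ω | t < f ω} + e) {Y : Ω} (hY : Y ∈ S) :
    ∫⁻ ω, ENNReal.ofReal (f ω + C) ∂(γ Y) ≤ ∫⁻ ω, ENNReal.ofReal (f ω + C) ∂μ + e * ENNReal.ofReal (2 * C) := by
  have hF : Measurable fun ω => ENNReal.ofReal (f ω + C) := (hf.add_const C).ennreal_ofReal
  rw [hDLR _ hF]
  calc ∫⁻ ω, ENNReal.ofReal (f ω + C) ∂(γ Y) = ∫⁻ _Y', ∫⁻ ω, ENNReal.ofReal (f ω + C) ∂(γ Y) ∂μ := by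
        rw [lintegral_const, measure_univ, mul_one]
    _ ≤ ∫⁻ Y', (∫⁻ ω, ENNReal.ofReal (f ω + C) ∂(γ Y') + e * ENNReal.ofReal (2 * C)) ∂μ :=
        lintegral_mono_ae (hS.mono fun Y' hY' => lintegral_shift_le_add_of_pinning γ hf hfC (hpin Y hY Y' hY'))
    _ = ∫⁻ Y', ∫⁻ ω, ENNReal.ofReal (f ω + C) ∂(γ Y') ∂μ + e * ENNReal.ofReal (2 * C) := by
        rw [lintegral_add_right' _ aemeasurable_const, lintegral_const, measure_univ, mul_one]

/-- **DLR transport of the pinning, lower bound**: in the same setting,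
`∫ (f + C) dμ ≤ ∫ (f + C) dγ_Y + 2 C e` for every `Y ∈ S`. [folklore] -/
theorem lintegral_le_lintegral_shift_add_of_pinning
    (hDLR : ∀ F : Ω → ℝ≥0∞, Measurable F → ∫⁻ X, F X ∂μ = ∫⁻ Y, ∫⁻ X, F X ∂(γ Y) ∂μ)
    {S : Set Ω} (hS : ∀ᵐ Y ∂μ, Y ∈ S) {f : Ω → ℝ} (hf : Measurable f) {C : ℝ} (hfC : ∀ ω, |f ω| ≤ C) {e : ℝ≥0∞}
    (hpin : ∀ Y ∈ S, ∀ Y' ∈ S, ∀ t : ℝ, γ Y {ω | t < f ω} ≤ γ Y' {ω | t < f ω} + e) {Y : Ω} (hY : Y ∈ S) :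
    ∫⁻ ω, ENNReal.ofReal (f ω + C) ∂μ ≤ ∫⁻ ω, ENNReal.ofReal (f ω + C) ∂(γ Y) + e * ENNReal.ofReal (2 * C) := by
  have hF : Measurable fun ω => ENNReal.ofReal (f ω + C) := (hf.add_const C).ennreal_ofReal
  rw [hDLR _ hF]
  calc ∫⁻ Y', ∫⁻ ω, ENNReal.ofReal (f ω + C) ∂(γ Y') ∂μ
      ≤ ∫⁻ _Y', (∫⁻ ω, ENNReal.ofReal (f ω + C) ∂(γ Y) + e * ENNReal.ofReal (2 * C)) ∂μ :=
        lintegral_mono_ae (hS.mono fun Y' hY' => lintegral_shift_le_add_of_pinning γ hf hfC (hpin Y' hY' Y hY))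
    _ = ∫⁻ ω, ENNReal.ofReal (f ω + C) ∂(γ Y) + e * ENNReal.ofReal (2 * C) := by
        rw [lintegral_const, measure_univ, mul_one]

/-- **The product with an outside observable, two-sided bound** (lower integrals): if in addition
`∫ F ψ dγ_Y = ψ(Y) ∫ F dγ_Y` for measurable `F` (`ψ` is frozen under `γ_Y`), then with `F = f + C`,
`∫ F ψ dμ ≤ (∫ F dμ + 2Ce) ∫ ψ dμ` and `∫ F dμ · ∫ ψ dμ ≤ ∫ F ψ dμ + 2Ce ∫ ψ dμ`. [folklore] -/
theorem lintegral_shift_mul_le_and_le_of_pinning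
    (hDLR : ∀ F : Ω → ℝ≥0∞, Measurable F → ∫⁻ X, F X ∂μ = ∫⁻ Y, ∫⁻ X, F X ∂(γ Y) ∂μ)
    {S : Set Ω} (hS : ∀ᵐ Y ∂μ, Y ∈ S) {f : Ω → ℝ} (hf : Measurable f) {C : ℝ} (hfC : ∀ ω, |f ω| ≤ C) {e : ℝ≥0∞}
    (hpin : ∀ Y ∈ S, ∀ Y' ∈ S, ∀ t : ℝ, γ Y {ω | t < f ω} ≤ γ Y' {ω | t < f ω} + e)
    {ψ : Ω → ℝ≥0∞} (hψ : Measurable ψ)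
    (hout : ∀ Y, ∀ F : Ω → ℝ≥0∞, Measurable F → ∫⁻ X, F X * ψ X ∂(γ Y) = (∫⁻ X, F X ∂(γ Y)) * ψ Y) :
    ∫⁻ ω, ENNReal.ofReal (f ω + C) * ψ ω ∂μ ≤
        (∫⁻ ω, ENNReal.ofReal (f ω + C) ∂μ + e * ENNReal.ofReal (2 * C)) * ∫⁻ ω, ψ ω ∂μ ∧
      (∫⁻ ω, ENNReal.ofReal (f ω + C) ∂μ) * ∫⁻ ω, ψ ω ∂μ ≤
        ∫⁻ ω, ENNReal.ofReal (f ω + C) * ψ ω ∂μ + e * ENNReal.ofReal (2 * C) * ∫⁻ ω, ψ ω ∂μ := by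
  have hF : Measurable fun ω => ENNReal.ofReal (f ω + C) := (hf.add_const C).ennreal_ofReal
  have hkey : ∫⁻ ω, ENNReal.ofReal (f ω + C) * ψ ω ∂μ =
      ∫⁻ Y, (∫⁻ ω, ENNReal.ofReal (f ω + C) ∂(γ Y)) * ψ Y ∂μ := by
    rw [hDLR (fun ω => ENNReal.ofReal (f ω + C) * ψ ω) (hF.mul hψ)]
    exact lintegral_congr fun Y => hout Y _ hF
  set I : ℝ≥0∞ := ∫⁻ ω, ENNReal.ofReal (f ω + C) ∂μ with hI
  set E : ℝ≥0∞ := e * ENNReal.ofReal (2 * C) with hE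
  constructor
  · rw [hkey]
    calc ∫⁻ Y, (∫⁻ ω, ENNReal.ofReal (f ω + C) ∂(γ Y)) * ψ Y ∂μ ≤ ∫⁻ Y, (I + E) * ψ Y ∂μ :=
          lintegral_mono_ae (hS.mono fun Y hY => mul_le_mul'
            (lintegral_shift_le_lintegral_add_of_pinning γ hDLR hS hf hfC hpin hY) le_rfl)
      _ = (I + E) * ∫⁻ Y, ψ Y ∂μ := lintegral_const_mul _ hψ
  · calc I * ∫⁻ ω, ψ ω ∂μ = ∫⁻ Y, I * ψ Y ∂μ := (lintegral_const_mul _ hψ).symm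
      _ ≤ ∫⁻ Y, ((∫⁻ ω, ENNReal.ofReal (f ω + C) ∂(γ Y)) * ψ Y + E * ψ Y) ∂μ := by
          refine lintegral_mono_ae (hS.mono fun Y hY => ?_)
          rw [← add_mul]
          exact mul_le_mul' (lintegral_le_lintegral_shift_add_of_pinning γ hDLR hS hf hfC hpin hY) le_rfl
      _ = ∫⁻ Y, (∫⁻ ω, ENNReal.ofReal (f ω + C) ∂(γ Y)) * ψ Y ∂μ + E * ∫⁻ Y, ψ Y ∂μ := by
          rw [lintegral_add_right' _ (hψ.const_mul E).aemeasurable, lintegral_const_mul _ hψ]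
      _ = _ := by rw [← hkey]

/-- From two-sided bounds in `ℝ≥0∞` to a real estimate: `a ≤ (b + E) c` and `b c ≤ a + E c` with everything finite
give `|a - b c| ≤ E c` after `toReal`. [folklore] -/
theorem abs_toReal_sub_toReal_mul_le {a b c E : ℝ≥0∞} (ha : a ≠ ∞) (hb : b ≠ ∞) (hc : c ≠ ∞) (hE : E ≠ ∞)
    (h1 : a ≤ (b + E) * c) (h2 : b * c ≤ a + E * c) :
    |a.toReal - b.toReal * c.toReal| ≤ E.toReal * c.toReal := by
  rw [abs_sub_le_iff]
  constructor
  · have h := ENNReal.toReal_mono (ENNReal.mul_ne_top (ENNReal.add_ne_top.2 ⟨hb, hE⟩) hc) h1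
    rw [ENNReal.toReal_mul, ENNReal.toReal_add hb hE, add_mul] at h
    linarith
  · have h := ENNReal.toReal_mono (ENNReal.add_ne_top.2 ⟨ha, ENNReal.mul_ne_top hE hc⟩) h2
    rw [ENNReal.toReal_add ha (ENNReal.mul_ne_top hE hc), ENNReal.toReal_mul, ENNReal.toReal_mul] at h
    linarith

/-- **Real form, non-negative outside observable**: `|E[(f + C) h] - E[f + C] E[h]| ≤ 2 C e E[h]` for `h ≥ 0`
integrable and frozen under the `γ_Y`. [folklore] -/
theorem abs_integral_shift_mul_sub_le_of_pinning
    (hDLR : ∀ F : Ω → ℝ≥0∞, Measurable F → ∫⁻ X, F X ∂μ = ∫⁻ Y, ∫⁻ X, F X ∂(γ Y) ∂μ)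
    {S : Set Ω} (hS : ∀ᵐ Y ∂μ, Y ∈ S) {f : Ω → ℝ} (hf : Measurable f) {C : ℝ} (hC : 0 ≤ C)
    (hfC : ∀ ω, |f ω| ≤ C) {e : ℝ≥0∞} (he : e ≠ ∞)
    (hpin : ∀ Y ∈ S, ∀ Y' ∈ S, ∀ t : ℝ, γ Y {ω | t < f ω} ≤ γ Y' {ω | t < f ω} + e)
    {h : Ω → ℝ} (hhm : Measurable h) (hh0 : ∀ ω, 0 ≤ h ω) (hhi : Integrable h μ)
    (hout : ∀ Y, ∀ F : Ω → ℝ≥0∞, Measurable F →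
      ∫⁻ X, F X * ENNReal.ofReal (h X) ∂(γ Y) = (∫⁻ X, F X ∂(γ Y)) * ENNReal.ofReal (h Y)) :
    |∫ ω, (f ω + C) * h ω ∂μ - (∫ ω, (f ω + C) ∂μ) * ∫ ω, h ω ∂μ| ≤ e.toReal * (2 * C) * ∫ ω, h ω ∂μ := by
  have hf0 : ∀ ω, 0 ≤ f ω + C := fun ω => by linarith [(abs_le.1 (hfC ω)).1]
  have hf2C : ∀ ω, f ω + C ≤ 2 * C := fun ω => by linarith [(abs_le.1 (hfC ω)).2]
  have hfm' : Measurable fun ω => f ω + C := hf.add_const C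
  have hψ : Measurable fun ω => ENNReal.ofReal (h ω) := hhm.ennreal_ofReal
  obtain ⟨h1, h2⟩ := lintegral_shift_mul_le_and_le_of_pinning γ hDLR hS hf hfC hpin hψ hout
  -- the three real integrals as `toReal`s of lower integrals
  have hfi : Integrable (fun ω => f ω + C) μ :=
    (integrable_const (2 * C)).mono' hfm'.aestronglyMeasurable (ae_of_all _ fun ω => by
      rw [Real.norm_eq_abs, abs_of_nonneg (hf0 ω)]; exact hf2C ω)
  have hfhi : Integrable (fun ω => (f ω + C) * h ω) μ :=
    hhi.bdd_mul hfm'.aestronglyMeasurable (ae_of_all _ fun ω => by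
      rw [Real.norm_eq_abs, abs_of_nonneg (hf0 ω)]; exact hf2C ω)
  have ea : ∫ ω, (f ω + C) * h ω ∂μ = (∫⁻ ω, ENNReal.ofReal (f ω + C) * ENNReal.ofReal (h ω) ∂μ).toReal := by
    rw [integral_eq_lintegral_of_nonneg_ae (ae_of_all _ fun ω => mul_nonneg (hf0 ω) (hh0 ω))
      hfhi.aestronglyMeasurable]
    congr 1
    exact lintegral_congr fun ω => ENNReal.ofReal_mul (hf0 ω)
  have eb : ∫ ω, (f ω + C) ∂μ = (∫⁻ ω, ENNReal.ofReal (f ω + C) ∂μ).toReal :=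
    integral_eq_lintegral_of_nonneg_ae (ae_of_all _ hf0) hfm'.aestronglyMeasurable
  have ec : ∫ ω, h ω ∂μ = (∫⁻ ω, ENNReal.ofReal (h ω) ∂μ).toReal :=
    integral_eq_lintegral_of_nonneg_ae (ae_of_all _ hh0) hhm.aestronglyMeasurable
  have ha : ∫⁻ ω, ENNReal.ofReal (f ω + C) * ENNReal.ofReal (h ω) ∂μ ≠ ∞ := by
    have h' := hfhi.lintegral_lt_top
    rw [lintegral_congr fun ω => (ENNReal.ofReal_mul (hf0 ω))] at h'
    exact h'.ne
  have hb : ∫⁻ ω, ENNReal.ofReal (f ω + C) ∂μ ≠ ∞ := hfi.lintegral_lt_top.ne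
  have hc : ∫⁻ ω, ENNReal.ofReal (h ω) ∂μ ≠ ∞ := hhi.lintegral_lt_top.ne
  have hE : e * ENNReal.ofReal (2 * C) ≠ ∞ := ENNReal.mul_ne_top he ENNReal.ofReal_ne_top
  have key := abs_toReal_sub_toReal_mul_le ha hb hc hE h1 h2
  rw [ea, eb, ec]
  rwa [ENNReal.toReal_mul, ENNReal.toReal_ofReal (by linarith)] at key

/-- **`|E_μ[f g] - E_μ[f] E_μ[g]| ≤ 2 C e E_μ|g|`** for `|f| ≤ C` pinned on superlevel sets between the `γ_Y`, `Y` in a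
set of full measure, and an integrable `g` all of whose (measurable) functions are frozen under every `γ_Y`
(decompose `g = g⁺ - g⁻` and shift `f` by `C`). [folklore] -/
theorem abs_integral_mul_sub_le_of_pinning
    (hDLR : ∀ F : Ω → ℝ≥0∞, Measurable F → ∫⁻ X, F X ∂μ = ∫⁻ Y, ∫⁻ X, F X ∂(γ Y) ∂μ)
    {S : Set Ω} (hS : ∀ᵐ Y ∂μ, Y ∈ S) {f : Ω → ℝ} (hf : Measurable f) {C : ℝ} (hC : 0 ≤ C)
    (hfC : ∀ ω, |f ω| ≤ C) {e : ℝ≥0∞} (he : e ≠ ∞)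
    (hpin : ∀ Y ∈ S, ∀ Y' ∈ S, ∀ t : ℝ, γ Y {ω | t < f ω} ≤ γ Y' {ω | t < f ω} + e)
    {g : Ω → ℝ} (hgm : Measurable g) (hgi : Integrable g μ)
    (hout : ∀ φ : ℝ → ℝ≥0∞, Measurable φ → ∀ Y, ∀ F : Ω → ℝ≥0∞, Measurable F →
      ∫⁻ X, F X * φ (g X) ∂(γ Y) = (∫⁻ X, F X ∂(γ Y)) * φ (g Y)) :
    |∫ ω, f ω * g ω ∂μ - (∫ ω, f ω ∂μ) * ∫ ω, g ω ∂μ| ≤ 2 * C * e.toReal * ∫ ω, |g ω| ∂μ := by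
  have hf0 : ∀ ω, 0 ≤ f ω + C := fun ω => by linarith [(abs_le.1 (hfC ω)).1]
  have hf2C : ∀ ω, f ω + C ≤ 2 * C := fun ω => by linarith [(abs_le.1 (hfC ω)).2]
  have hfm' : Measurable fun ω => f ω + C := hf.add_const C
  have hbd : ∀ᵐ ω ∂μ, ‖f ω + C‖ ≤ 2 * C := ae_of_all _ fun ω => by
    rw [Real.norm_eq_abs, abs_of_nonneg (hf0 ω)]; exact hf2C ω
  -- positive and negative parts of `g`
  have hp := abs_integral_shift_mul_sub_le_of_pinning γ hDLR hS hf hC hfC he hpin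
    (hgm.max measurable_const) (fun ω => le_max_right _ _) hgi.pos_part
    (fun Y F hF => hout (fun x => ENNReal.ofReal (max x 0)) (by fun_prop) Y F hF)
  have hn := abs_integral_shift_mul_sub_le_of_pinning γ hDLR hS hf hC hfC he hpin (h := fun ω => max (-g ω) 0)
    (hgm.neg.max measurable_const) (fun ω => le_max_right _ _) hgi.neg_part
    (fun Y F hF => hout (fun x => ENNReal.ofReal (max (-x) 0)) (by fun_prop) Y F hF)
  -- integrability bookkeeping
  have hfi : Integrable (fun ω => f ω + C) μ := (integrable_const (2 * C)).mono' hfm'.aestronglyMeasurable hbd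
  have hfint : Integrable f μ := (integrable_const C).mono' hf.aestronglyMeasurable
    (ae_of_all _ fun ω => by rw [Real.norm_eq_abs]; exact hfC ω)
  have hfg : Integrable (fun ω => (f ω + C) * g ω) μ := hgi.bdd_mul hfm'.aestronglyMeasurable hbd
  have hfgp : Integrable (fun ω => (f ω + C) * max (g ω) 0) μ := hgi.pos_part.bdd_mul hfm'.aestronglyMeasurable hbd
  have hfgn : Integrable (fun ω => (f ω + C) * max (-g ω) 0) μ :=
    hgi.neg_part.bdd_mul hfm'.aestronglyMeasurable hbd
  have hfg' : Integrable (fun ω => f ω * g ω) μ :=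
    hgi.bdd_mul hf.aestronglyMeasurable (ae_of_all _ fun ω => by rw [Real.norm_eq_abs]; exact hfC ω)
  -- the algebra
  have e1 : ∫ ω, f ω * g ω ∂μ - (∫ ω, f ω ∂μ) * ∫ ω, g ω ∂μ =
      ∫ ω, (f ω + C) * g ω ∂μ - (∫ ω, (f ω + C) ∂μ) * ∫ ω, g ω ∂μ := by
    have i1 : ∫ ω, (f ω + C) * g ω ∂μ = ∫ ω, f ω * g ω ∂μ + C * ∫ ω, g ω ∂μ := by
      rw [← integral_const_mul, ← integral_add hfg' (hgi.const_mul C)]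
      exact integral_congr_ae (ae_of_all _ fun ω => by ring)
    have i2 : ∫ ω, (f ω + C) ∂μ = ∫ ω, f ω ∂μ + C := by
      rw [integral_add hfint (integrable_const C), integral_const, probReal_univ, one_smul]
    rw [i1, i2]; ring
  have e2 : ∫ ω, (f ω + C) * g ω ∂μ = ∫ ω, (f ω + C) * max (g ω) 0 ∂μ - ∫ ω, (f ω + C) * max (-g ω) 0 ∂μ := by
    rw [← integral_sub hfgp hfgn]
    exact integral_congr_ae (ae_of_all _ fun ω => by
      simp only
      rw [← mul_sub, max_zero_sub_max_neg_zero_eq_self])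
  have e3 : ∫ ω, g ω ∂μ = ∫ ω, max (g ω) 0 ∂μ - ∫ ω, max (-g ω) 0 ∂μ := by
    rw [← integral_sub hgi.pos_part hgi.neg_part]
    exact integral_congr_ae (ae_of_all _ fun ω => (max_zero_sub_max_neg_zero_eq_self (g ω)).symm)
  have e4 : ∫ ω, |g ω| ∂μ = ∫ ω, max (g ω) 0 ∂μ + ∫ ω, max (-g ω) 0 ∂μ := by
    rw [← integral_add hgi.pos_part hgi.neg_part]
    exact integral_congr_ae (ae_of_all _ fun ω => (max_zero_add_max_neg_zero_eq_abs_self (g ω)).symm)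
  rw [e1, e2, e3, e4]
  calc |∫ ω, (f ω + C) * max (g ω) 0 ∂μ - ∫ ω, (f ω + C) * max (-g ω) 0 ∂μ -
          (∫ ω, (f ω + C) ∂μ) * (∫ ω, max (g ω) 0 ∂μ - ∫ ω, max (-g ω) 0 ∂μ)|
      = |(∫ ω, (f ω + C) * max (g ω) 0 ∂μ - (∫ ω, (f ω + C) ∂μ) * ∫ ω, max (g ω) 0 ∂μ) -
          (∫ ω, (f ω + C) * max (-g ω) 0 ∂μ - (∫ ω, (f ω + C) ∂μ) * ∫ ω, max (-g ω) 0 ∂μ)| := by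
        congr 1; ring
    _ ≤ |∫ ω, (f ω + C) * max (g ω) 0 ∂μ - (∫ ω, (f ω + C) ∂μ) * ∫ ω, max (g ω) 0 ∂μ| +
          |∫ ω, (f ω + C) * max (-g ω) 0 ∂μ - (∫ ω, (f ω + C) ∂μ) * ∫ ω, max (-g ω) 0 ∂μ| := abs_sub _ _
    _ ≤ e.toReal * (2 * C) * ∫ ω, max (g ω) 0 ∂μ + e.toReal * (2 * C) * ∫ ω, max (-g ω) 0 ∂μ := add_le_add hp hn
    _ = 2 * C * e.toReal * (∫ ω, max (g ω) 0 ∂μ + ∫ ω, max (-g ω) 0 ∂μ) := by ring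

/-- **Covariance form**: `|Cov_μ(f, g)| ≤ 2 C e ‖g‖_{L¹(μ)}` for `f, g` as above with `g ∈ L²(μ)`. [folklore] -/
theorem abs_cov_le_of_pinning
    (hDLR : ∀ F : Ω → ℝ≥0∞, Measurable F → ∫⁻ X, F X ∂μ = ∫⁻ Y, ∫⁻ X, F X ∂(γ Y) ∂μ)
    {S : Set Ω} (hS : ∀ᵐ Y ∂μ, Y ∈ S) {f : Ω → ℝ} (hf : Measurable f) {C : ℝ} (hC : 0 ≤ C)
    (hfC : ∀ ω, |f ω| ≤ C) {e : ℝ≥0∞} (he : e ≠ ∞)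
    (hpin : ∀ Y ∈ S, ∀ Y' ∈ S, ∀ t : ℝ, γ Y {ω | t < f ω} ≤ γ Y' {ω | t < f ω} + e)
    {g : Ω → ℝ} (hgm : Measurable g) (hg2 : MemLp g 2 μ)
    (hout : ∀ φ : ℝ → ℝ≥0∞, Measurable φ → ∀ Y, ∀ F : Ω → ℝ≥0∞, Measurable F →
      ∫⁻ X, F X * φ (g X) ∂(γ Y) = (∫⁻ X, F X ∂(γ Y)) * φ (g Y)) :
    |cov[f, g; μ]| ≤ 2 * C * e.toReal * ∫ ω, |g ω| ∂μ := by
  have hf2 : MemLp f 2 μ := memLp_of_bounded (a := -C) (b := C)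
    (ae_of_all _ fun ω => ⟨(abs_le.1 (hfC ω)).1, (abs_le.1 (hfC ω)).2⟩) hf.aestronglyMeasurable 2
  rw [covariance_eq_sub hf2 hg2]
  exact abs_integral_mul_sub_le_of_pinning γ hDLR hS hf hC hfC he hpin hgm (hg2.integrable one_le_two) hout

/-- **Registered helper stub (part 1a of `stub_staticClustering`)**: the abstract `φ`-mixing covariance inequality
`abs_cov_le_of_pinning` in closed form. [folklore] -/
theorem staticClustering_pinningCovariance : ∀ (Ω : Type) [MeasurableSpace Ω] (μ : Measure Ω) [IsProbabilityMeasure μ] (γ : Ω → Measure Ω), (∀ F : Ω → ℝ≥0∞, Measurable F → ∫⁻ X, F X ∂μ = ∫⁻ Y, ∫⁻ X, F X ∂(γ Y) ∂μ) → ∀ (S : Set Ω), (∀ᵐ Y ∂μ, Y ∈ S) → ∀ (f : Ω → ℝ), Measurable f → ∀ (C : ℝ), 0 ≤ C → (∀ ω, |f ω| ≤ C) → ∀ (e : ℝ≥0∞), e ≠ ∞ → (∀ Y ∈ S, ∀ Y' ∈ S, ∀ t : ℝ, γ Y {ω | t < f ω} ≤ γ Y' {ω | t < f ω} + e) → ∀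 (g : Ω → ℝ), Measurable g → MemLp g 2 μ → (∀ φ : ℝ → ℝ≥0∞, Measurable φ → ∀ Y, ∀ F : Ω → ℝ≥0∞, Measurable F → ∫⁻ X, F X * φ (g X) ∂(γ Y) = (∫⁻ X, F X ∂(γ Y)) * φ (g Y)) → |cov[f, g; μ]| ≤ 2 * C * e.toReal * ∫ ω, |g ω| ∂μ :=
  fun _Ω _ _μ _ γ hDLR _S hS _f hf _C hC hfC _e he hpin _g hgm hg2 hout =>
    abs_cov_le_of_pinning γ hDLR hS hf hC hfC he hpin hgm hg2 hout

end Abstract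

end Summit.AtomisticToContinuum.HydrodynamicLimit.Theorems.MourreKoopmanChargesStressStrongMixing

end
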